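import Literature.AlgebraicGeometry.Modules.Torsion
import Literature.AlgebraicGeometry.Modules.AffineLocalizing
import HarnessLib

/-!
# The torsion subsheaf `M[𝒥]` of an affine-localizing module is affine-localizing (for `𝒥` locally finitely generated)

For a scheme `X`, an ideal sheaf `J : X.IdealSheafData` whose affine components `𝒥(V)` are finitely
generated (e.g. `X` locally Noetherian) and a sheaf of `𝒪_X`-modules `M` which is affine-localizing
(`Literature/AlgebraicGeometry/Modules/AffineLocalizing`: numerators and torsion on principal opens of
affine opens, EGA I 1.4.1 d1), d2)), the `𝒥`-torsion subsheaf `M[𝒥]`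
(`Literature/AlgebraicGeometry/Modules/Torsion`) is again affine-localizing. This is the affine-local
content of "`𝓗om_{𝒪_X}(𝒪_X/𝒥, M)` is quasi-coherent for `𝒥` of finite type and `M` quasi-coherent"
(The Stacks Project, Tag 01LA with 01CM; Görtz–Wedhorn I, Prop. 7.29): numerators — if `r^a s = x|` in
`M` for a torsion section `s` over `D(r)`, then each generator `j_i` of `𝒥(V)` has `(j_i x)|_{D(r)} = 0`,
so `r^{b} j_i x = 0` for a common `b`, and `r^b x` is a torsion section extending `r^{a+b} s`; torsion is
inherited from `M`.

* `isAffineLocalizing_torsion` — the theorem.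

Everything is proved; no named facts. Mathlib searched (pin v4.32): `Ideal.span`, `Submodule.span_le`,
`Ideal.torsionOf` / `Ideal.mem_torsionOf_iff`, `Finset.sup`/`Finset.le_sup`, `pow_sub_mul_pow` (used).

## References

* The Stacks Project, Tags 01LA, 01CM (Modules: quasi-coherence of `𝓗om` from a finitely presented
  module). [StacksProject]
* R. Hartshorne, *Algebraic Geometry*, GTM 52 (1977): II Lemma 5.3 (p. 112), II Ex. 5.6 (p. 124).
  [Hartshorne1977]
-/

noncomputable section

open CategoryTheory AlgebraicGeometry TopologicalSpace Opposite

universe u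

namespace Literature.AlgebraicGeometry.Modules

variable {X : Scheme.{u}} {M : X.Modules} (J : X.IdealSheafData)

/-- **`M[𝒥]` is affine-localizing** for `M` affine-localizing and `𝒥` with finitely generated affine
components. [cite: Hartshorne1977, II Lemma 5.3 p. 112 (PDF p. 141)] -/
theorem isAffineLocalizing_torsion (hM : IsAffineLocalizing M)
    (hJ : ∀ V : X.affineOpens, (J.ideal V).FG) : IsAffineLocalizing (torsion M J) := by
  classical
  constructor
  · intro V hV r W hW s
    have hι : W ≤ V := hW.le.trans (X.basicOpen_le r)
    have hWaff : IsAffineOpen W := hW ▸ hV.basicOpen r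
    -- numerators in `M` for the underlying section
    obtain ⟨a, x, hx⟩ := hM.numerator hV r hW ((torsionι M J).app W s)
    -- each generator of `𝒥(V)` kills `x` after multiplication by a power of `r`
    obtain ⟨G, hG⟩ := hJ ⟨V, hV⟩
    have hkill : ∀ j ∈ G, ∃ b : ℕ, r ^ b • (j • x) = 0 := by
      intro j hj
      have hjJ : j ∈ J.ideal ⟨V, hV⟩ := hG ▸ Ideal.subset_span hj
      refine hM.torsion hV r (j • x) hι (hW ▸ le_rfl) ?_
      rw [Scheme.Modules.map_smul, hx, smul_smul, mul_comm, mul_smul]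
      have hs := (isTorsionSection_iff_of_isAffineOpen M J hWaff ((torsionι M J).app W s)).mp
        (isTorsionSection_torsionι_app M J W s) (X.presheaf.map (homOfLE hι).op j)
        (J.ideal_le_comap_ideal (U := ⟨W, hWaff⟩) (V := ⟨V, hV⟩) hι hjJ)
      rw [hs, smul_zero]
    choose! b hb using hkill
    set B := G.sup b with hB
    -- `r^B • x` is a torsion section over the affine `V`
    have htor : IsTorsionSection M J V (r ^ B • x) := by
      rw [isTorsionSection_iff_of_isAffineOpen M J hV]
      intro j hj
      rw [← hG] at hj
      refine Submodule.span_induction (p := fun j _ => j • (r ^ B • x) = 0) ?_ ?_ ?_ ?_ hj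
      · intro j hjG
        rw [smul_comm, ← pow_sub_mul_pow r (Finset.le_sup hjG : b j ≤ B), mul_smul, hb j hjG, smul_zero]
      · rw [zero_smul]
      · intro j j' _ _ h h'
        rw [add_smul, h, h', add_zero]
      · intro t j _ h
        rw [smul_eq_mul, mul_smul, h, smul_zero]
    obtain ⟨y, hy⟩ := exists_torsionι_app_eq M J (r ^ B • x) htor
    refine ⟨a + B, y, torsionι_app_injective M J W ?_⟩
    have nat := (ConcreteCategory.congr_hom ((torsionι M J).mapPresheaf.naturality (homOfLE hι).op) y)
    change (torsionι M J).app W ((Literature.AlgebraicGeometry.Modules.torsion M J).presheaf.map _ y) =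
      M.presheaf.map (homOfLE hι).op ((torsionι M J).app V y) at nat
    rw [Scheme.Modules.Hom.app_smul, nat, hy, Scheme.Modules.map_smul, hx, smul_smul, map_pow, ← pow_add,
      add_comm]
  · intro V hV r y W hWV hrW hy
    have h0 : M.presheaf.map (homOfLE hWV).op ((torsionι M J).app V y) = 0 := by
      have nat := (ConcreteCategory.congr_hom ((torsionι M J).mapPresheaf.naturality (homOfLE hWV).op) y)
      change (torsionι M J).app W ((Literature.AlgebraicGeometry.Modules.torsion M J).presheaf.map _ y) =
        M.presheaf.map (homOfLE hWV).op ((torsionι M J).app V y) at nat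
      rw [← nat, hy, map_zero]
    obtain ⟨n, hn⟩ := hM.torsion hV r ((torsionι M J).app V y) hWV hrW h0
    refine ⟨n, torsionι_app_injective M J V ?_⟩
    rw [Scheme.Modules.Hom.app_smul, hn, map_zero]

end Literature.AlgebraicGeometry.Modules

end
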